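import Literature.NumberTheory.EllipticCurves.Kato2004.EllipticUnitKummerCupValues
import HarnessLib

/-!
# Kato 2004 (Astérisque 295) Prop. 15.9 / (15.9.1) on the Kummer–cup classes WITH the CM-linearity of the `exp*`-value
# datum (`h159″ = CM.prop159_kummerCup_expStar_values_linear`), and the projection `h159″ → h159′`

Topic `NumberTheory/EllipticCurves`, sub-directory `Kato2004`, namespace `…Kato2004.CM` (the namespace of
`h159′ = CM.prop159_kummerCup_expStar_values`, `EllipticUnitKummerCupValues.lean`).  Cell `bsd-cm`, seat `bsd-cm-k-ty1` g33
(literature-prover), planner ruling D1107 (R4) («h159″ := h159′'s body + the `O_K ⊗ ℤ_p`-linearity of the `exp*`-functional on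
the Kummer column; new file, statement only + the projection»).  ONE named fact (`h159″`, a PUBLISHED theorem: Kato Prop. 15.9
with §15.12, plus the naturality of the dual exponential of Bloch–Kato in the normalised CM identification `End_K(A_K) = O_K`)
and the PROVED projection `prop159_kummerCup_expStar_values_of_linear : h159″ → h159′` (drop the added clause).  No instance,
no notation, no `sorry`; `h159′` and every other tree file are untouched.

## What is added to `h159′`, and why

`h159′` binds ONE period `Ω ≠ 0` and ONE value datum `𝔏 = (𝔏_U)_U` (`𝔏_U : H¹(U, T_pA_K) →ₗ[ℤ_p] ℚ_p ⊗_ℤ K̄`, read as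
«`exp* ∘ loc_p` followed by (15.8.1) in the coordinate `ω` of `S(ψ)`») and asserts `EllipticZetaBody` for the Kummer–cup
classes of every pinned unit tower; of the datum `𝔏` it records only the axioms (Z3a) (`Γ_K`-equivariance on the normal layers
`U_{pⁿf} = Gal(K̄/K(A_K[pⁿf]))`) and (Z3b) (locality at `p`).  Kato's datum has one more PRINTED structure, used by the cell's
consumer (the field (e2) «CM-functoriality» of `KatoExpDatum`, `Summits/…/Additive/RamifiedSevenGenusKatoExpReadingValues.lean`,
`ExpStarCMShape`): it is LINEAR for the complex multiplication.  Precisely —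

* `End_K(A_K) = O_K` through the normalised isomorphism `[·]` (`[α]^* ω = α ω` on the invariant differential)
  [Silverman ATAEC II Prop. 1.1; Kato §15.3 (p. 252) «`A` has CM by `O_K`»]; an endomorphism `φ` with `φ ∘ φ = [m]`, `m ∈ ℤ`,
  is `[α]` with `α ∈ O_K`, `α² = m`;
* the dual exponential map is NATURAL in the Galois representation [Bloch–Kato Def. 3.10 and Ex. 3.11 (the exponential of an
  abelian variety; functoriality); Kato LNM 1553 Ch. II §1.2.4]: `exp*_{V} ∘ (T_pφ)_* = D_dR(φ) ∘ exp*_{V}` on every finite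
  layer `K′/K`, and `D_dR(φ)` acts on the cotangent line `Fil⁰ D_dR(V_pA_K) ⊗ K′ = K′·ω` by the scalar `α` (or `ᾱ`; both are
  square roots of `m` in `K`);
* the identifications (15.8.1) (`per_ψ`, `L`-linear, p. 257), (15.11.1)–(15.11.2) (fixed for the rest of §15, p. 262) and the
  map (15.12.1) («a canonical homomorphism of `O_λ[[G_{p^∞𝔣}]]`-modules … where `T` is any `Gal(Q̄/K)`-stable `O_λ`-lattice of
  `V_{L_λ}(ψ)`», p. 263; here `L = K`, `λ ∣ p`), followed by `exp*` in (15.12.2), are `O_λ`-linear; 15.13–15.14 (pp. 263–264)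
  keep the `O_λ[[G]]`-module structure on `H^q(T)` (15.14: the modification for `K ⊂ ℚ(ζ_{p^∞})`, the case `p = 7`,
  `K = ℚ(√−7) ⊂ ℚ(ζ_7)` of the cell).

Hence, in the tree's `𝔏`-currency: for every `K`-endomorphism `φ` of `A_K` with `φ ∘ φ = [m]` there is `μ ∈ K` with `μ² = m`
such that on every normal layer `U = U_{pⁿf}`
  `𝔏_U (φ_* c) = (1 ⊗ μ) · 𝔏_U (c)`   (`φ_* = isogenyLayerMapK p φ U`, the push-forward on `H¹(U, T_pA_K)`),
which is exactly the letter of the tree's PROVED local shape `Kato2004.expStarCoord_endo_eq_mul`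
(`ExpStarCoordIsogenyProofs.lean`: `exp*_ω(φ_* η) = μ · exp*_ω(η) ∧ μ² = m` for the DEFINED scalar dual exponential of
`PAdicHodge/DualExpElliptic.lean`) transported to the abstract global datum `𝔏` of Prop. 15.9.  `h159″` is `h159′` with this
ONE clause — (Z3c) below — inserted after the binder `∃ 𝔏`; the orientation (which square root) is NOT asserted (it is `α`
or `ᾱ` according to the variance conventions, and the consumer orients its frame: `expStarCMShape_or_negSqrt`).

HONEST FRAMING: one named fact transcribing published statements (Kato Prop. 15.9/(15.9.1) read on the typed map, as `h159′`,
plus Bloch–Kato naturality in the CM normalisation), one projection theorem; +1 named fact at filing, pre-authorised by the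
planner (D1107 (R4): `h159″` replaces `h159′` as conjunct 17 of `stub_printFactsKato` at the next skeleton touch, net 0 then);
nothing about BSD or about any particular curve is proved; no summit statement, route file or constructor is touched;
`stmt-BirchSwinnertonDyer-19945` stays OPEN.

## References

* [Kato2004Asterisque] K. Kato, Astérisque 295 (2004), §15.3 (p. 252), §15.5–(15.6.1) (p. 253), §15.8 (15.8.1) (p. 257),
  Prop. 15.9 and (15.9.1) (pp. 258–259), Lemma 15.11 (15.11.1)–(15.11.2) (pp. 260–262), (15.12.1)–(15.12.2) (p. 263),
  15.13–15.14 (pp. 263–264).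
* [BlochKato1990] S. Bloch, K. Kato, *L-functions and Tamagawa numbers of motives* (1990), Def. 3.10 and Ex. 3.11 (p. 361).
* [Kato1993LNM1553] K. Kato, LNM 1553 (1993), Ch. II §1.2.4 (naturality of `exp*`).
* [SilvermanATAEC1994] J. H. Silverman, *Advanced Topics in the Arithmetic of Elliptic Curves* (1994), II Prop. 1.1
  (the normalised `[·] : O_K ≅ End(E)`, `[α]^*ω = αω`), II Thm. 2.2 (b) (endomorphisms defined over `K(j) = K` here).
* [BurungaleFlach2024] A. Burungale, M. Flach (2024), Prop. 3.1 (the instance `K′ = K` of Prop. 15.9).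
* Tree: `Kato2004/EllipticUnitKummerCupValues.lean` (`h159′`), `Kato2004/EllipticZetaReciprocity.lean` (`EllipticZetaBody`,
  `tateRepK`, `torsionLayer`), `Kato2004/IwasawaCohomologyNumberFieldIsogeny.lean` (`isogenyLayerMapK`),
  `Kato2004/ExpStarCoordIsogenyProofs.lean` (`expStarCoord_endo_eq_mul`, the proved local letter of (Z3c)).
-/

noncomputable section

open scoped NumberField TensorProduct
open Field IsDedekindDomain NumberField
open Literature.NumberTheory.GaloisRepresentations
open Literature.NumberTheory.EllipticCurves
open Literature.NumberTheory.ComplexMultiplication.EllipticUnits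

namespace Literature.NumberTheory.EllipticCurves.Kato2004

namespace CM

/-! ## §1 The named fact `h159″`: `h159′` with the CM-linearity (Z3c) of the value datum `𝔏` -/

/-- **Kato 2004, Prop. 15.9 in the displayed form (15.9.1) (pp. 258–259), READ ON THE MAP (15.6.1)∘(15.12.1), WITH THE
`O_K`-LINEARITY OF THE `exp*`-VALUE DATUM — `h159″`.**  Verbatim the binders, the admissibility and the conclusion of
`prop159_kummerCup_expStar_values` (`h159′`): `A/ℚ` globally minimal with CM by the maximal order of `K`
(`A.j ∈ maximalCMJInvariants`, `IsCMFieldOfJ K A.j`), `ψ` the Grössencharacter (type `(1,0)`, `L(ψ, s) = L(A, s)`),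
`ι : K̄ → ℂ` extending the infinite place, `f ≥ 3` with `cond(ψ) ∣ (f)`, any prime `p` (instance binder
`ContinuousSMul ℤ_[p] (T_pA_K)`), any Kummer frame `F` of `A_K` at `p` on the ray-class tower (`F.V s = Gal(K̄/K(A_K[p^s f]))`)
with `γ = (e k)_k ≠ 0`; THEN there are ONE period `Ω ≠ 0` and ONE value datum `𝔏 = (𝔏_U)_U` such that
**(Z3c) [the added clause] `𝔏` is linear for the complex multiplication: for every `K`-endomorphism `φ` of `A_K` with
`φ ∘ φ = [m]` (`m ∈ ℤ`) there is `μ ∈ K` with `μ² = m` and `𝔏_U(φ_* c) = (1 ⊗ μ)·𝔏_U(c)` for every normal layer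
`U = Gal(K̄/K(A_K[pⁿf]))` and every class `c ∈ H¹(U, T_pA_K)`** — `End_K(A_K) = O_K` normalised by `[α]^*ω = αω`, so
`φ = [α]`, `α² = m`; `exp*` is natural in the representation (`exp* ∘ (T_pφ)_* = D_dR(φ) ∘ exp*`) and `D_dR(φ)` is the scalar
`α` (or `ᾱ`) on the cotangent line `K′·ω`; the readings (15.8.1), (15.11.1)–(15.11.2) and the map (15.12.1) («homomorphism of
`O_λ[[G_{p^∞𝔣}]]`-modules», `T` an `O_λ`-lattice) are `O_λ`-linear; the orientation of `μ` is NOT asserted — AND, as in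
`h159′`, for EVERY ideal `𝔞` prime to `6pf` and EVERY unit tower `u` on `F` pinned to Kato's units `_𝔞z_{p^s𝔣}` at the levels
`s ≥ 1` there are values `y` with `EllipticZetaBody K A_K p ψ f ι Ω 𝔏 𝔞 (F.tateClass u) y` ((Z1) norm compatibility, (Z2)
integrality, (Z3a)/(Z3b) datum axioms, (Z4) rationality, (Z5) the value law (15.9.1)).  Hypotheses transcribed: as `h159′`.
NOT here: (15.9.2), (15.6.4), any Λ-module statement, any identification of `Ω` with a Néron period, the sign of `μ`, any proof.
Named fact (PUBLISHED: Kato Prop. 15.9 with §15.5–15.6, §15.8, §15.11–15.12; Bloch–Kato Def. 3.10/Ex. 3.11; the CM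
normalisation); nothing asserted; no `_holds` expected (size XL); the local letter of (Z3c) is the tree's proved
`Kato2004.expStarCoord_endo_eq_mul`. [cite: Kato2004Asterisque, Prop. 15.9 and (15.9.1) (pp. 258–259), with §15.3 (p. 252),
§15.5–(15.6.1) (p. 253), (15.8.1) (p. 257), Lemma 15.11 (15.11.1)–(15.11.2) (pp. 260–262), (15.12.1)–(15.12.2) (p. 263),
15.13–15.14 (pp. 263–264)] [cite: BlochKato1990, Def. 3.10 and Ex. 3.11 (p. 361)] [cite: Kato1993LNM1553, Ch. II §1.2.4]
[cite: SilvermanATAEC1994, II Prop. 1.1 and II Thm. 2.2 (b)] [cite: BurungaleFlach2024, Prop. 3.1] -/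
def prop159_kummerCup_expStar_values_linear : Prop :=
  ∀ (A : WeierstrassCurve ℚ) [A.IsElliptic] [A.IsGloballyMinimal], A.j ∈ maximalCMJInvariants →
  ∀ (K : Type) [Field K] [NumberField K], IsCMFieldOfJ K A.j →
  ∀ (ψ : HeckeCharacter K), ψ.HasInfinityType (fun _ ↦ 1) (fun _ ↦ 0) →
    (∀ s : ℂ, 3 / 2 < s.re → heckeLFunction ψ s = A.LSeries s) →
  ∀ (ι : AlgebraicClosure K →+* ℂ),
    (∀ (w : InfinitePlace K) (x : K), ι (algebraMap K (AlgebraicClosure K) x) = w.embedding x) →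
  ∀ (f : ℕ), 3 ≤ f →
    (∀ α : 𝓞 K, α ≠ 0 → ((f : ℕ) : 𝓞 K) ∣ α - 1 →
      heckeCharIdealValue ψ (Ideal.span {α}) = ι (algebraMap K (AlgebraicClosure K) (α : K))) →
  ∀ (p : ℕ) [Fact p.Prime] [ContinuousSMul ℤ_[p] ((A.baseChange K).tateModule p)],
  ∀ (F : KummerFrame (A.baseChange K) p),
    (∀ s : ℕ, F.V s = torsionLayer (A.baseChange K) (p ^ s * f)) → (∃ k : ℕ, F.e k ≠ 0) →
    ∃ Ω : ℂ, Ω ≠ 0 ∧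
    ∃ 𝔏 : ∀ U : Subgroup (absoluteGaloisGroup K),
        H1 (tateRepK (A.baseChange K) p) U →ₗ[ℤ_[p]] ℚ_[p] ⊗[ℤ] AlgebraicClosure K,
    -- (Z3c) CM-linearity of the value datum on the normal layers [BK Def. 3.10/Ex. 3.11 + `End_K(A_K) = O_K`; (15.12.1)]
    (∀ (φ : WeierstrassCurve.Isogeny (A.baseChange K) (A.baseChange K)) (m : ℤ), (∀ P, φ (φ P) = m • P) →
      ∃ μ : K, μ ^ 2 = (m : K) ∧
        ∀ (n : ℕ) (c : H1 (tateRepK (A.baseChange K) p) (torsionLayer (A.baseChange K) (p ^ n * f))),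
          𝔏 (torsionLayer (A.baseChange K) (p ^ n * f))
              (isogenyLayerMapK p φ (torsionLayer (A.baseChange K) (p ^ n * f)) c) =
            ((1 : ℚ_[p]) ⊗ₜ[ℤ] algebraMap K (AlgebraicClosure K) μ) *
              𝔏 (torsionLayer (A.baseChange K) (p ^ n * f)) c) ∧
    ∀ 𝔞 : Ideal (𝓞 K), IsCoprime 𝔞 (Ideal.span {((6 * p * f : ℕ) : 𝓞 K)}) →
    ∀ u : F.UnitTower, (∀ s : ℕ, 1 ≤ s → IsKatoUnitRepAt p ι (Ideal.span {((f : ℕ) : 𝓞 K)}) s 𝔞 (u.z s)) →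
      ∃ y : Subgroup (absoluteGaloisGroup K) → AlgebraicClosure K,
        EllipticZetaBody K (A.baseChange K) p ψ f ι Ω 𝔏 𝔞 (F.tateClass u) y

/-! ## §2 The projection `h159″ → h159′` -/

/-- **`h159″ → h159′`**: dropping the CM-linearity clause (Z3c) recovers `prop159_kummerCup_expStar_values` verbatim (same
`Ω`, same `𝔏`). [cite: Kato2004Asterisque, Prop. 15.9 and (15.9.1) (pp. 258–259)] -/
theorem prop159_kummerCup_expStar_values_of_linear (h : prop159_kummerCup_expStar_values_linear) :
    prop159_kummerCup_expStar_values := by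
  intro A _ _ hA K _ _ hK ψ hψ hL ι hι f hf hcond p _ _ F hFV he
  obtain ⟨Ω, hΩ, 𝔏, -, hbody⟩ := h A hA K hK ψ hψ hL ι hι f hf hcond p F hFV he
  exact ⟨Ω, hΩ, 𝔏, hbody⟩

end CM

end Literature.NumberTheory.EllipticCurves.Kato2004

end
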